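import Literature.MathematicalPhysics.QuantumLattice.ApproximatingHamiltonianProofs
import Literature.MathematicalPhysics.QuantumLattice.FermionTraceFactorization
import Literature.MathematicalPhysics.QuantumLattice.FermionEmbedding
import Literature.MathematicalPhysics.QuantumLattice.HubbardGaugeBound

/-!
# Crux `TwSeededEnsembleEquivalenceR` (stmt-HubbardSuperconductivity-15581), line `cold-floor-collapse`
# (slug `Sketch`) — stub S3 `stub_sourcedPressureLimit`, layer 1: the log-partition function of
# decoupled and of embedded lattice-fermion Hamiltonians

Support file (`--supports stmt-HubbardSuperconductivity-15581`; sorry-free; no definition). Generic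
Fock-space facts (orbital set `ι`, Fock space `Finset ι → ℂ`, Jordan–Wigner matrices of the tree) used
by the thermodynamic limit of the sourced torus pressure:

* `log_partitionFn_zero'`, `abs_log_partitionFn_le`: `log Z_β(0) = |ι| log 2` and the a priori bound
  `|log Z_β(H)| ≤ β‖H‖ + |ι| log 2`;
* `partitionFn_add_mul_two_pow`, `log_partitionFn_add_of_mem`, **`log_partitionFn_sum_of_mem`**: for
  Hermitian `X_j` in the EVEN CAR subalgebras of pairwise disjoint orbital sets,
  `log Z(Σ_j X_j) + #J·|ι| log 2 = Σ_j log Z(X_j) + |ι| log 2` (graded commutativity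
  `commute_of_mem_carEvenSubalgebra` + product property of the trace `trace_mul_of_mem_carSubalgebra`,
  tree file `FermionTraceFactorization`; Bratteli–Robinson II §5.2.2, Ueltschi 1999 §2.1);
* `log_partitionFn_jwEmbed`: along an order embedding `e : ι ↪o ι'`,
  `log Z(jwEmbed e H) = log Z(H) + (|ι'| − |ι|) log 2` (`trace_exp_jwEmbed`, tree file `FermionEmbedding`);
* small algebra: products of two creation operators are even (two annihilations: see
  `EnslavedA1gUpperSandwichLocalityAbstract`), norms of two-operator products and of `aM + (aM)ᴴ`.

Sources: O. Bratteli, D. W. Robinson, *Operator Algebras and QSM II* §5.2.2 (CAR algebra as a graded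
product, product trace state); D. Ueltschi, J. Stat. Phys. 95 (1999) 693 §2.1; D. Ruelle, *Statistical
Mechanics* (1969) §2.3 (these are the two inputs of the subadditivity argument for quantum lattice gases).
-/

-- the mandated namespace `Summit.<Summit>.<Problem>.Theorems…` repeats `HubbardSuperconductivity`
set_option linter.dupNamespace false

namespace Summit.HubbardSuperconductivity.HubbardSuperconductivity.Theorems.TwSeededEnsembleEquivalenceR.ColdFloorLine

open Matrix Finset Literature.MathematicalPhysics.QuantumLattice
open scoped ComplexOrder Matrix.Norms.L2Operator

noncomputable section

variable {ι : Type*} [LinearOrder ι] [Fintype ι]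

/-! ### The free partition function and the a priori bound -/

/-- `Z_β(0) = 2^{|ι|}` on the Fock space of the orbital set `ι`. [folklore] -/
theorem partitionFn_zero' (β : ℝ) :
    partitionFn β (0 : Matrix (Finset ι) (Finset ι) ℂ) = 2 ^ Fintype.card ι := by
  rw [partitionFn, gibbsWeight, smul_zero, NormedSpace.exp_zero, trace_one, Fintype.card_finset]
  push_cast
  rfl

/-- `log Z_β(0) = |ι| log 2`. [folklore] -/
theorem log_partitionFn_zero' (β : ℝ) :
    Real.log (partitionFn β (0 : Matrix (Finset ι) (Finset ι) ℂ)).re = Fintype.card ι * Real.log 2 := by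
  rw [partitionFn_zero']
  have : ((2 : ℂ) ^ Fintype.card ι).re = (2 : ℝ) ^ Fintype.card ι := by
    rw [← Complex.ofReal_ofNat, ← Complex.ofReal_pow, Complex.ofReal_re]
  rw [this, Real.log_pow]

/-- **A priori bound**: `|log Z_β(H)| ≤ β‖H‖ + |ι| log 2` for Hermitian `H` and `β ≥ 0`
(Lipschitz continuity of `log Z` against `H = 0`). [folklore] -/
theorem abs_log_partitionFn_le {H : Matrix (Finset ι) (Finset ι) ℂ} (hH : H.IsHermitian) {β : ℝ}
    (hβ : 0 ≤ β) : |Real.log (partitionFn β H).re| ≤ β * ‖H‖ + Fintype.card ι * Real.log 2 := by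
  have h := abs_log_partitionFn_sub_log_partitionFn_le hH (isHermitian_zero) hβ
  rw [sub_zero, log_partitionFn_zero'] at h
  have h2 : 0 ≤ (Fintype.card ι : ℝ) * Real.log 2 := by positivity
  rw [abs_le] at h ⊢
  constructor <;> nlinarith [h.1, h.2, abs_nonneg (Real.log (partitionFn β H).re)]

/-! ### Decoupled Hamiltonians: factorisation of the partition function -/

/-- **Factorisation**: for `A` in the even CAR subalgebra of `S₁` and `B` in the CAR subalgebra of a
disjoint `S₂`, `Z_β(A + B) · 2^{|ι|} = Z_β(A) · Z_β(B)` (`e^{-β(A+B)} = e^{-βA} e^{-βB}` by graded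
commutativity, then the product property of the normalised trace).
[folklore: Bratteli–Robinson II §5.2.2; Ueltschi 1999 §2.1] -/
theorem partitionFn_add_mul_two_pow {S₁ S₂ : Finset ι} {A B : Matrix (Finset ι) (Finset ι) ℂ}
    (hA : A ∈ carEvenSubalgebra S₁) (hB : B ∈ carSubalgebra S₂) (hS : Disjoint S₁ S₂) (β : ℝ) :
    partitionFn β (A + B) * 2 ^ Fintype.card ι = partitionFn β A * partitionFn β B := by
  have hA' : -(β : ℂ) • A ∈ carEvenSubalgebra S₁ := Subalgebra.smul_mem _ hA _
  have hB' : -(β : ℂ) • B ∈ carSubalgebra S₂ := Subalgebra.smul_mem _ hB _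
  have hc : Commute (-(β : ℂ) • A) (-(β : ℂ) • B) := commute_of_mem_carEvenSubalgebra hA' hB' hS
  simp only [partitionFn, gibbsWeight]
  rw [smul_add, Matrix.exp_add_of_commute _ _ hc]
  exact trace_mul_of_mem_carSubalgebra (exp_mem_subalgebra _ (carEvenSubalgebra_le_carSubalgebra _ hA'))
    (exp_mem_subalgebra _ hB') hS

/-- The real part of `Z` is `Z` (Hermitian Hamiltonian). [folklore] -/
theorem ofReal_partitionFn_re {H : Matrix (Finset ι) (Finset ι) ℂ} (hH : H.IsHermitian) (β : ℝ) :
    (((partitionFn β H).re : ℝ) : ℂ) = partitionFn β H :=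
  (partitionFn_eq_re hH β).symm

/-- **Factorisation in logarithmic form**: `log Z(A + B) + |ι| log 2 = log Z(A) + log Z(B)` for
Hermitian `A`, `B` as in `partitionFn_add_mul_two_pow`. [folklore] -/
theorem log_partitionFn_add_of_mem {S₁ S₂ : Finset ι} {A B : Matrix (Finset ι) (Finset ι) ℂ}
    (hA : A ∈ carEvenSubalgebra S₁) (hB : B ∈ carSubalgebra S₂) (hS : Disjoint S₁ S₂)
    (hAh : A.IsHermitian) (hBh : B.IsHermitian) (β : ℝ) :
    Real.log (partitionFn β (A + B)).re + Fintype.card ι * Real.log 2 =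
      Real.log (partitionFn β A).re + Real.log (partitionFn β B).re := by
  have h := partitionFn_add_mul_two_pow hA hB hS β
  have hABh : (A + B).IsHermitian := hAh.add hBh
  rw [← ofReal_partitionFn_re hABh, ← ofReal_partitionFn_re hAh, ← ofReal_partitionFn_re hBh] at h
  have h' : (partitionFn β (A + B)).re * 2 ^ Fintype.card ι =
      (partitionFn β A).re * (partitionFn β B).re := by exact_mod_cast h
  have hpA := partitionFn_re_pos hAh β
  have hpB := partitionFn_re_pos hBh β
  have hpAB := partitionFn_re_pos hABh β
  have h2 : (0 : ℝ) < 2 ^ Fintype.card ι := by positivity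
  have := congrArg Real.log h'
  rw [Real.log_mul hpAB.ne' h2.ne', Real.log_mul hpA.ne' hpB.ne', Real.log_pow] at this
  linarith

/-- A sum of elements of the CAR subalgebras of the `S j` lies in the CAR subalgebra of their union.
[folklore] -/
theorem sum_mem_carSubalgebra_biUnion {J : Type*} [DecidableEq J] (T : Finset J) (S : J → Finset ι)
    (X : J → Matrix (Finset ι) (Finset ι) ℂ) (hX : ∀ j ∈ T, X j ∈ carEvenSubalgebra (S j)) :
    ∑ j ∈ T, X j ∈ carSubalgebra (T.biUnion S) :=
  Subalgebra.sum_mem _ fun j hj =>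
    carSubalgebra_mono (Finset.subset_biUnion_of_mem S hj) (carEvenSubalgebra_le_carSubalgebra _ (hX j hj))

/-- **Factorisation over finitely many disjoint regions**: for Hermitian `X_j` in the even CAR
subalgebras of pairwise disjoint orbital sets `S_j` (`j ∈ T`),
`log Z(Σ_{j ∈ T} X_j) + #T · |ι| log 2 = Σ_{j ∈ T} log Z(X_j) + |ι| log 2`.
[folklore: Bratteli–Robinson II §5.2.2; Ruelle 1969 §2.3] -/
theorem log_partitionFn_sum_of_mem {J : Type*} [DecidableEq J] (T : Finset J) (S : J → Finset ι)
    (X : J → Matrix (Finset ι) (Finset ι) ℂ) (hX : ∀ j ∈ T, X j ∈ carEvenSubalgebra (S j))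
    (hXh : ∀ j ∈ T, (X j).IsHermitian) (hS : ∀ j ∈ T, ∀ j' ∈ T, j ≠ j' → Disjoint (S j) (S j'))
    (β : ℝ) :
    Real.log (partitionFn β (∑ j ∈ T, X j)).re + T.card * (Fintype.card ι * Real.log 2) =
      ∑ j ∈ T, Real.log (partitionFn β (X j)).re + Fintype.card ι * Real.log 2 := by
  induction T using Finset.induction_on with
  | empty => simp [log_partitionFn_zero']
  | @insert a T haT ih =>
    have hXT : ∀ j ∈ T, X j ∈ carEvenSubalgebra (S j) := fun j hj => hX j (Finset.mem_insert_of_mem hj)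
    have hXhT : ∀ j ∈ T, (X j).IsHermitian := fun j hj => hXh j (Finset.mem_insert_of_mem hj)
    have hST : ∀ j ∈ T, ∀ j' ∈ T, j ≠ j' → Disjoint (S j) (S j') := fun j hj j' hj' =>
      hS j (Finset.mem_insert_of_mem hj) j' (Finset.mem_insert_of_mem hj')
    have ih' := ih hXT hXhT hST
    have hdisj : Disjoint (S a) (T.biUnion S) := by
      rw [Finset.disjoint_biUnion_right]
      intro j hj
      exact hS a (Finset.mem_insert_self a T) j (Finset.mem_insert_of_mem hj) (fun h => haT (h ▸ hj))
    have hsumh : (∑ j ∈ T, X j).IsHermitian := by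
      rw [Matrix.IsHermitian, Matrix.conjTranspose_sum]
      exact Finset.sum_congr rfl fun i hi => (hXhT i hi).eq
    have h2 := log_partitionFn_add_of_mem (hX a (Finset.mem_insert_self a T))
      (sum_mem_carSubalgebra_biUnion T S X hXT) hdisj (hXh a (Finset.mem_insert_self a T)) hsumh β
    rw [Finset.sum_insert haT, Finset.sum_insert haT, Finset.card_insert_of_notMem haT]
    push_cast
    linarith

/-! ### Embedded Hamiltonians -/

/-- `jwEmbed` preserves Hermiticity. [folklore] -/
theorem isHermitian_jwEmbed {ι' : Type*} [LinearOrder ι'] [Fintype ι'] (e : ι ↪o ι')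
    {H : Matrix (Finset ι) (Finset ι) ℂ} (hH : H.IsHermitian) : (jwEmbed e H).IsHermitian := by
  rw [IsHermitian, ← jwEmbed_conjTranspose, hH.eq]

/-- **Volume independence of the normalised partition function**: along an order embedding of
orbital sets, `log Z(jwEmbed e H) = log Z(H) + (|ι'| − |ι|) log 2` for Hermitian `H`.
[folklore: Bratteli–Robinson II §5.2.2; Ueltschi 1999 §2.3] -/
theorem log_partitionFn_jwEmbed {ι' : Type*} [LinearOrder ι'] [Fintype ι'] (e : ι ↪o ι')
    {H : Matrix (Finset ι) (Finset ι) ℂ} (hH : H.IsHermitian) (β : ℝ) :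
    Real.log (partitionFn β (jwEmbed e H)).re =
      Real.log (partitionFn β H).re + ((Fintype.card ι' : ℝ) - Fintype.card ι) * Real.log 2 := by
  have hle : Fintype.card ι ≤ Fintype.card ι' := Fintype.card_le_of_embedding e.toEmbedding
  have h1 : partitionFn β (jwEmbed e H) = 2 ^ (Fintype.card ι' - Fintype.card ι) * partitionFn β H := by
    simp only [partitionFn, gibbsWeight]
    rw [← map_smul, trace_exp_jwEmbed]
  have h2 : (partitionFn β (jwEmbed e H)).re =
      (2 : ℝ) ^ (Fintype.card ι' - Fintype.card ι) * (partitionFn β H).re := by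
    rw [h1, ← ofReal_partitionFn_re hH]
    norm_cast
  have hp := partitionFn_re_pos hH β
  rw [h2, Real.log_mul (by positivity) hp.ne', Real.log_pow, Nat.cast_sub hle]
  ring

/-! ### Small algebra: even two-operator products, norms -/

/-- `c†_i c†_j` is even. [folklore] -/
theorem creation_mul_creation_mem_carEvenSubalgebra {S : Finset ι} {i j : ι} (hi : i ∈ S)
    (hj : j ∈ S) : creation i * creation j ∈ carEvenSubalgebra S :=
  Algebra.subset_adjoin ⟨(i, true), (j, true), hi, hj, rfl⟩

/-- `‖c†_i c_j‖ ≤ 1`, `‖c_i c_j‖ ≤ 1`, `‖c†_i c†_j‖ ≤ 1`: all four two-operator products have norm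
`≤ 1`. [folklore] -/
theorem norm_two_product_le_one (i j : ι) :
    ‖creation i * annihilation j‖ ≤ 1 ∧ ‖annihilation i * annihilation j‖ ≤ 1 ∧
      ‖creation i * creation j‖ ≤ 1 ∧ ‖annihilation i * creation j‖ ≤ 1 := by
  have hc := norm_creation_le_one (ι := ι)
  have ha := norm_annihilation_le_one (ι := ι)
  refine ⟨?_, ?_, ?_, ?_⟩ <;>
    exact (norm_mul_le _ _).trans (mul_le_one₀ (by simp [hc, ha]) (norm_nonneg _) (by simp [hc, ha]))

/-- `‖a • M + (a • M)ᴴ‖ ≤ 2 ‖a‖ ‖M‖`. [folklore] -/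
theorem norm_smul_add_conjTranspose_le (a : ℂ) (M : Matrix (Finset ι) (Finset ι) ℂ) :
    ‖a • M + (a • M)ᴴ‖ ≤ 2 * ‖a‖ * ‖M‖ := by
  refine (norm_add_le _ _).trans ?_
  rw [Matrix.l2_opNorm_conjTranspose, norm_smul]
  ring_nf
  rfl

/-! ### Summary (registered sub-goal of stmt-HubbardSuperconductivity-15581) -/

/-- **Registered sub-goal `spl_logPartitionToolkit`** (layer 1 of `stub_sourcedPressureLimit`):
factorisation of `log Z` over disjoint even blocks and volume independence along order embeddings, for
orbital types in `Type`. [folklore] -/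
theorem spl_logPartitionToolkit : (∀ (ι : Type) [LinearOrder ι] [Fintype ι] (J : Type) [DecidableEq J] (T : Finset J) (S : J → Finset ι) (X : J → Matrix (Finset ι) (Finset ι) ℂ), (∀ j ∈ T, X j ∈ carEvenSubalgebra (S j)) → (∀ j ∈ T, (X j).IsHermitian) → (∀ j ∈ T, ∀ j' ∈ T, j ≠ j' → Disjoint (S j) (S j')) → ∀ β : ℝ, Real.log (Matrix.partitionFn β (∑ j ∈ T, X j)).re + T.card * (Fintype.card ι * Real.log 2) = ∑ j ∈ T, Real.log (Matrix.partitionFn β (X j)).re + Fintype.card ι * Real.log 2) ∧ (∀ (ι ι' : Type) [LinearOrder ι] [Fintype ι] [LinearOrder ι'] [Fintype ι'] (e : ι ↪o ι') (H : Matrix (Finset ι) (Finset ι) ℂ), H.IsHermitian → ∀ β : ℝ, Real.log (Matrix.partitionFn β (jwEmbed e H)).re = Real.log (Matrix.partitionFn β H).re + ((Fintype.card ι' : ℝ) - Fintype.card ι) * Real.log 2) :=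
  ⟨fun _ _ _ _ _ T S X hX hXh hS β => log_partitionFn_sum_of_mem T S X hX hXh hS β,
    fun _ _ _ _ _ _ e _ hH β => log_partitionFn_jwEmbed e hH β⟩

end

end Summit.HubbardSuperconductivity.HubbardSuperconductivity.Theorems.TwSeededEnsembleEquivalenceR.ColdFloorLine
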